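import Literature.AlgebraicGeometry.Motives.HodgeStructureCentralizerCenterFieldExtension
import HarnessLib

/-!
# THE CENTRE OF `S(A)` ALONG A FIELD EXTENSION `k ⊆ k'` — REMARK 1.6 «`S'(A) ≅ S(A)_{/k'}`» FOR `S₀`: `γ_L ∈ Z(S(H)(L)) ⟺ γ ∈ Z(S(H)(K))`,
# THE INJECTION `Z(S(H)(K)) ↪ Z(S(H)(L))` OVER `γ ↦ γ_L`, `#Z(S(H)(K)) ≤ ∕ ∣ #Z(S(H)(L))`, AND FOR THE FIRST KIND
# `2^{t_K} ≤ 2^{t_L}` WITH `Z(S(H)(K)) ≅ Z(S(H)(L))` IFF `t_K = t_L` (Milne 1999 §1 Remark 1.6, p. 645 `S₀`, §2 p. 646, Summary p. 652)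

[topic AlgebraicGeometry/Motives]

Layer `Literature/AlgebraicGeometry/Motives`, lane `lit-hodgefound` (Track 2 foundations library; prover seat
`lit-hodgefound-p02`, generation 56, self-proposed row g56-#2). THEOREMS ONLY: no definition, no named fact (net debt `0`),
no instance, no notation.  Group-side companion of g56-#1 (`Motives/HodgeStructureCentralizerCenterFieldExtension`: the centre
`C₀ ⊗ K` of the ALGEBRA `C(H)(K)` along `K → L`, `t_K ≤ t_L`).  Milne's Remark 1.6 «`S'(A) ≅ S(A)_{/k'}`» says that enlarging the
coefficient field base-changes the algebraic group `S(A)`; the tree reads it through the functor of points: `γ ↦ γ_L`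
(`glExtendScalars`, `Motives/MumfordTateGroupFieldExtension`) identifies `S(H)(K)` with the elements of `S(H)(L)` defined over `K`
(p34 g19-#4 `Polarization.glExtendScalars_mem_lefschetzGroupBaseChange_iff`, `Motives/HodgeStructureLefschetzGroupFieldExtension`).
Here the same is PROVED for the CENTRE `S₀ = Z(S) = S ∩ (C₀ ⊗ ·)` (Milne p. 645; on points g54-#4
`Polarization.mem_center_lefschetzGroupBaseChange_iff_mem_span`), for every polarized `ℚ`-Hodge structure `(H, ψ)` on a
finite-dimensional `V` and all fields `ℚ ⊆ K ⊆ L` (any universes):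
(i) `γ ↦ γ_L` is injective on `GL(K ⊗ V)` and `↑γ_L` is the `L`-extension of `↑γ` (`γ_L ∘ j = j ∘ γ`);
(ii) `γ ∈ Z(S(H)(K)) ⟹ γ_L ∈ Z(S(H)(L))` — `↑γ ∈ E_φ ⊗ K = span_K {a_K}` is carried by LEMMA A of g56-#1 to `↑γ_L ∈ span_L {a_L}`;
and conversely `γ_L` central ⟹ `γ` central (`(γδ)_L = (δγ)_L` and injectivity), so
**`Z(S(H)(K)) = (γ ↦ γ_L)⁻¹ Z(S(H)(L))`** — the `K`-points of `S₀` are the `L`-points of `S₀` defined over `K`;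
(iii) an injective homomorphism `Z(S(H)(K)) →* Z(S(H)(L))` over `γ ↦ γ_L`; hence `Z(S(H)(K))` infinite ⟹ `Z(S(H)(L))` infinite
(g54-#10 is `K = ℚ`), `#Z(S(H)(K)) ∣ #Z(S(H)(L))`, and `#Z(S(H)(K)) ≤ #Z(S(H)(L))` when the latter is finite;
(iv) FIRST KIND (g55-#8 `#Z(S(H)(K)) = 2^{t_K}`): `#Z(S(H)(K)) ≤ #Z(S(H)(L))` always, `=` iff `t_K = t_L`, and then `γ ↦ γ_L` is an
isomorphism `Z(S(H)(K)) ≅ Z(S(H)(L))` («`1 = e₁ + ⋯ + e_t`»: no factor of `C₀ ⊗ K` splits further in `L`).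

## The sources, verbatim

* J. S. Milne, *Lefschetz classes on abelian varieties*, Duke Math. J. 96 (1999) 639–675 [Milne1999LefschetzClasses] (held
  `paper:doi-10-1215-s0012-7094-99-09620-5`): folio 6 = p. 644 L16–L20 «`S(A)(R) = {γ ∈ C(A) ⊗_k R | γ†γ = 1}` for all
  commutative `k`-algebras `R`», L30–L37 «**Remark 1.6.** … there are canonical isomorphisms `C'(A) ≅ C(A) ⊗_k k'`,
  `S'(A) ≅ S(A)_{/k'}`.»; folio 7 = p. 645 L2–L6 «let `C₀(A)` be the centre of the `ℚ`-algebra `End⁰(A)` — it is a product of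
  fields … `S₀(A)(R) = {γ ∈ C₀(A) ⊗_ℚ R | γ†γ = 1}`»; folio 8 = p. 646 L33–L38 «`F ⊗_ℚ k = F₁ × ⋯ × F_t` … `1 = e₁ + ⋯ + e_t`»;
  §2 Summary p. 652 («Semisimple: I, II, III yes; IV no»).
* B. J. J. Moonen, Yu. G. Zarhin, *Weil classes on abelian varieties*, J. reine angew. Math. 496 (1998) 83–92
  [MoonenZarhin1998WeilClasses], §1 Lemma (1) (the centre `U_{K_B}(R) = {a ∈ (K_B ⊗_ℚ R)^* ∣ a a† = 1}`, finite except in type 4).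
* P. Deligne, *Hodge cycles on abelian varieties*, LNM 900 (1982) [Deligne1982HodgeCycles], I §3.1 (groups through points;
  extension of scalars in the proof of Prop. 3.1).
* N. Bourbaki, *Algebra I* [BourbakiAlgebraI1989], Ch. II §5 no. 3 Prop. 7 (extension of scalars along a field extension is faithful).

Nearest tree results, BY NAME: `glExtendScalars_extendScalars`, `glExtendScalarsHom` (`Motives/MumfordTateGroupFieldExtension`);
`Polarization.glExtendScalars_mem_lefschetzGroupBaseChange_iff`, `Polarization.comap_glExtendScalarsHom_lefschetzGroupBaseChange`
(`S(H)(K) = (γ ↦ γ_L)⁻¹ S(H)(L)`); g54-#4 `Polarization.mem_center_lefschetzGroupBaseChange_iff_mem_span`; g54-#10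
`Polarization.exists_center_lefschetzGroup_to_center_lefschetzGroupBaseChange_injective` (`ℚ → K`); g55-#8
`Polarization.natCard_center_lefschetzGroupBaseChange_eq_two_pow`, `Polarization.finite_center_lefschetzGroupBaseChange_of_forall_adjoint_eq_self`;
g56-#1 `mem_span_image_baseChange_of_extendScalars_comm` (LEMMA A), `natCard_maximalSpectrum_center_centralizer_le` (`t_K ≤ t_L`).

## Dictionary and what is proved

`γ_L = glExtendScalars K L V γ`, `j = extendScalars K L V`, `S(H)(K) = ψ.lefschetzGroupBaseChange K`, `Z(·) = Subgroup.center`,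
`t_K = Nat.card (MaximalSpectrum (Subalgebra.center K C(H)(K)))`; "first kind" = `∀ z ∈ Z(E_φ), z† = z`.

* §1 (namespace `Literature.AlgebraicGeometry.Motives`) **`coe_glExtendScalars_extendScalars`**, **`glExtendScalars_injective`**,
  `glExtendScalarsHom_injective`.
* §2 (namespace `…Motives.HodgeStructure`) **`Polarization.glExtendScalars_mem_center_lefschetzGroupBaseChange`** (`γ` central ⟹
  `γ_L` central), **`Polarization.glExtendScalars_mem_center_lefschetzGroupBaseChange_iff`**,
  **`Polarization.comap_center_lefschetzGroupBaseChange_eq_center`** (`Z(S(H)(K))` = preimage of `Z(S(H)(L))` under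
  `S(H)(K) → S(H)(L)`), **`Polarization.exists_center_lefschetzGroupBaseChange_monoidHom_injective`**,
  `Polarization.infinite_center_lefschetzGroupBaseChange_of_infinite_of_tower`,
  `Polarization.finite_center_lefschetzGroupBaseChange_of_finite_of_tower`, **`Polarization.natCard_center_lefschetzGroupBaseChange_le_of_finite`**,
  **`Polarization.natCard_center_lefschetzGroupBaseChange_dvd`**.
* §3 first kind: **`Polarization.natCard_center_lefschetzGroupBaseChange_le_of_forall_adjoint_eq_self`**,
  **`Polarization.natCard_center_lefschetzGroupBaseChange_eq_iff_natCard_maximalSpectrum_eq`** (`#Z_K = #Z_L ↔ t_K = t_L`),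
  **`Polarization.exists_center_lefschetzGroupBaseChange_mulEquiv_of_natCard_maximalSpectrum_eq`** (`t_K = t_L` ⟹ `Z(S(H)(K)) ≅ Z(S(H)(L))`).
-/

noncomputable section

open scoped TensorProduct

namespace Literature.AlgebraicGeometry.Motives

universe u u' v

/-! ## §1 `γ ↦ γ_L` on `GL`: injective, and `↑γ_L` is the `L`-extension of `↑γ` -/

section GLExtend

variable (K : Type u) (L : Type u') [Field K] [Field L] [Algebra ℚ K] [Algebra ℚ L] [Algebra K L]
  [IsScalarTower ℚ K L] (V : Type v) [AddCommGroup V] [Module ℚ V]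

/-- **`↑γ_L` IS THE `L`-EXTENSION OF `↑γ`**: `γ_L (j x) = j (γ x)` for the underlying linear maps. [cite: Deligne1982HodgeCycles, I §3.1] -/
theorem coe_glExtendScalars_extendScalars (γ : (K ⊗[ℚ] V) ≃ₗ[K] (K ⊗[ℚ] V)) (x : K ⊗[ℚ] V) :
    ((glExtendScalars K L V γ : (L ⊗[ℚ] V) ≃ₗ[L] (L ⊗[ℚ] V)) : Module.End L (L ⊗[ℚ] V)) (extendScalars K L V x) =
      extendScalars K L V (((γ : (K ⊗[ℚ] V) ≃ₗ[K] (K ⊗[ℚ] V)) : Module.End K (K ⊗[ℚ] V)) x) := by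
  rw [LinearEquiv.coe_coe, LinearEquiv.coe_coe, glExtendScalars_extendScalars]

/-- **`γ ↦ γ_L : GL(K ⊗ V) → GL(L ⊗ V)` IS INJECTIVE** (`j` is injective and `γ_L ∘ j = j ∘ γ`). [cite: BourbakiAlgebraI1989, Ch. II §5 no. 3 Prop. 7] -/
theorem glExtendScalars_injective : Function.Injective (glExtendScalars K L V) := fun γ γ' h =>
  LinearEquiv.ext fun x => extendScalars_injective K L V (by
    rw [← glExtendScalars_extendScalars, ← glExtendScalars_extendScalars, h])

/-- The monoid-hom spelling: `glExtendScalarsHom K L V` is injective. [cite: BourbakiAlgebraI1989, Ch. II §5 no. 3 Prop. 7] -/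
theorem glExtendScalarsHom_injective : Function.Injective (glExtendScalarsHom K L V) :=
  glExtendScalars_injective K L V

end GLExtend

namespace HodgeStructure

/-! ## §2 The centre of `S(H)` along `K → L`: `γ_L ∈ Z(S(H)(L)) ⟺ γ ∈ Z(S(H)(K))` -/

section Centre

variable (K : Type u) (L : Type u') [Field K] [Field L] [Algebra ℚ K] [Algebra ℚ L] [Algebra K L]
  [IsScalarTower ℚ K L] {V : Type v} [AddCommGroup V] [Module ℚ V] [Module.Finite ℚ V] {n : ℤ} {H : HodgeStructure V n}
  (ψ : Polarization H)

omit [Module.Finite ℚ V] in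
/-- The image spelling of `E_φ ⊗ K`: `range (a ↦ a_K : E_φ → End) = (· _K) '' E_φ`. [folklore] -/
private theorem range_baseChange_endAlg_eq_image₅₆₂ :
    (Set.range fun a : H.endAlg => (a : Module.End ℚ V).baseChange K) =
      (fun z : Module.End ℚ V => z.baseChange K) '' (H.endAlg : Set (Module.End ℚ V)) := by
  rw [Set.image_eq_range]
  rfl

/-- **`γ ∈ Z(S(H)(K)) ⟹ γ_L ∈ Z(S(H)(L))`**: `γ` central means `↑γ ∈ E_φ ⊗ K = span_K {a_K}` (g54-#4
`Polarization.mem_center_lefschetzGroupBaseChange_iff_mem_span`), LEMMA A moves this to `↑γ_L ∈ span_L {a_L} = E_φ ⊗ L`, and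
`γ_L ∈ S(H)(L)` (Remark 1.6 on points) — so `γ_L` is central: the map `S₀(K) → S₀(L)` of «`S'(A) ≅ S(A)_{/k'}`» for the centre
`S₀ = S ∩ (C₀ ⊗ ·)`. [cite: Milne1999LefschetzClasses, §1 Remark 1.6 (p. 644), p. 644 L16–L20 and p. 645 L2–L6 (`C₀`, `S₀`)]
[cite: Deligne1982HodgeCycles, I §3 Prop. 3.1 (proof: extension of scalars)] -/
theorem Polarization.glExtendScalars_mem_center_lefschetzGroupBaseChange {γ : ψ.lefschetzGroupBaseChange K}
    (hγ : γ ∈ Subgroup.center (ψ.lefschetzGroupBaseChange K)) :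
    (⟨glExtendScalars K L V (γ : (K ⊗[ℚ] V) ≃ₗ[K] (K ⊗[ℚ] V)),
        (ψ.glExtendScalars_mem_lefschetzGroupBaseChange_iff K L _).2 γ.2⟩ : ψ.lefschetzGroupBaseChange L) ∈
      Subgroup.center (ψ.lefschetzGroupBaseChange L) := by
  rw [ψ.mem_center_lefschetzGroupBaseChange_iff_mem_span K, range_baseChange_endAlg_eq_image₅₆₂ K] at hγ
  rw [ψ.mem_center_lefschetzGroupBaseChange_iff_mem_span L, range_baseChange_endAlg_eq_image₅₆₂ L]
  exact mem_span_image_baseChange_of_extendScalars_comm K L V (coe_glExtendScalars_extendScalars K L V _) hγ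

/-- **`γ_L ∈ Z(S(H)(L)) ⟺ γ ∈ Z(S(H)(K))`** — THE `K`-POINTS OF THE CENTRE ARE THE `L`-POINTS OF THE CENTRE DEFINED OVER `K`
(«`S'(A) ≅ S(A)_{/k'}`» for `S₀`): "⟹" because every `δ ∈ S(H)(K)` has `δ_L ∈ S(H)(L)`, and `γ_L δ_L = δ_L γ_L` is `(γδ)_L = (δγ)_L`
with `γ ↦ γ_L` injective. [cite: Milne1999LefschetzClasses, §1 Remark 1.6 (p. 644) and p. 645 L2–L6 (`S₀`)] -/
theorem Polarization.glExtendScalars_mem_center_lefschetzGroupBaseChange_iff (γ : ψ.lefschetzGroupBaseChange K) :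
    (⟨glExtendScalars K L V (γ : (K ⊗[ℚ] V) ≃ₗ[K] (K ⊗[ℚ] V)),
        (ψ.glExtendScalars_mem_lefschetzGroupBaseChange_iff K L _).2 γ.2⟩ : ψ.lefschetzGroupBaseChange L) ∈
      Subgroup.center (ψ.lefschetzGroupBaseChange L) ↔ γ ∈ Subgroup.center (ψ.lefschetzGroupBaseChange K) := by
  refine ⟨fun h => Subgroup.mem_center_iff.2 fun δ => ?_, ψ.glExtendScalars_mem_center_lefschetzGroupBaseChange K L⟩
  have hδ := Subgroup.mem_center_iff.1 h ⟨glExtendScalars K L V (δ : (K ⊗[ℚ] V) ≃ₗ[K] (K ⊗[ℚ] V)),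
    (ψ.glExtendScalars_mem_lefschetzGroupBaseChange_iff K L _).2 δ.2⟩
  have hδ' := congrArg Subtype.val hδ
  simp only [Subgroup.coe_mul] at hδ'
  refine Subtype.ext (glExtendScalars_injective K L V ?_)
  rw [Subgroup.coe_mul, Subgroup.coe_mul]
  simpa only [← glExtendScalarsHom_apply, map_mul] using hδ'

/-- **`Z(S(H)(K)) = Z(S(H)(L)) ×_{S(H)(L)} S(H)(K)`: the centre of `S(H)(K)` is the preimage of the centre of `S(H)(L)` under the
homomorphism `S(H)(K) → S(H)(L)`, `γ ↦ γ_L`** (Remark 1.6 for the subgroup `S₀`). [cite: Milne1999LefschetzClasses, §1 Remark 1.6 (p. 644) and p. 645 L2–L6 (`S₀`)] -/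
theorem Polarization.comap_center_lefschetzGroupBaseChange_eq_center :
    (Subgroup.center (ψ.lefschetzGroupBaseChange L)).comap
        (((glExtendScalarsHom K L V).restrict (ψ.lefschetzGroupBaseChange K)).codRestrict (ψ.lefschetzGroupBaseChange L)
          fun γ => (ψ.glExtendScalars_mem_lefschetzGroupBaseChange_iff K L _).2 γ.2) =
      Subgroup.center (ψ.lefschetzGroupBaseChange K) := by
  ext γ
  rw [Subgroup.mem_comap]
  exact ψ.glExtendScalars_mem_center_lefschetzGroupBaseChange_iff K L γ

/-- **THE INJECTIVE HOMOMORPHISM `Z(S(H)(K)) → Z(S(H)(L))` OVER `γ ↦ γ_L`** (`S₀(K) ↪ S₀(L)`; stated as an existence because the file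
introduces no definition). [cite: Milne1999LefschetzClasses, §1 Remark 1.6 (p. 644) and p. 645 L2–L6 (`S₀`)] -/
theorem Polarization.exists_center_lefschetzGroupBaseChange_monoidHom_injective :
    ∃ f : Subgroup.center (ψ.lefschetzGroupBaseChange K) →* Subgroup.center (ψ.lefschetzGroupBaseChange L),
      Function.Injective f ∧ ∀ γ : Subgroup.center (ψ.lefschetzGroupBaseChange K),
        (((f γ : Subgroup.center (ψ.lefschetzGroupBaseChange L)) : ψ.lefschetzGroupBaseChange L) :
            (L ⊗[ℚ] V) ≃ₗ[L] (L ⊗[ℚ] V)) =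
          glExtendScalars K L V ((γ : ψ.lefschetzGroupBaseChange K) : (K ⊗[ℚ] V) ≃ₗ[K] (K ⊗[ℚ] V)) := by
  refine ⟨{ toFun := fun γ => ⟨_, ψ.glExtendScalars_mem_center_lefschetzGroupBaseChange K L γ.2⟩,
            map_one' := Subtype.ext (Subtype.ext ?_),
            map_mul' := fun γ γ' => Subtype.ext (Subtype.ext ?_) }, fun γ γ' h => ?_, fun γ => rfl⟩
  · change glExtendScalars K L V 1 = 1
    rw [← glExtendScalarsHom_apply, map_one]
  · change glExtendScalars K L V (((γ : ψ.lefschetzGroupBaseChange K) : (K ⊗[ℚ] V) ≃ₗ[K] (K ⊗[ℚ] V)) *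
        ((γ' : ψ.lefschetzGroupBaseChange K) : (K ⊗[ℚ] V) ≃ₗ[K] (K ⊗[ℚ] V))) =
      glExtendScalars K L V ((γ : ψ.lefschetzGroupBaseChange K) : (K ⊗[ℚ] V) ≃ₗ[K] (K ⊗[ℚ] V)) *
        glExtendScalars K L V ((γ' : ψ.lefschetzGroupBaseChange K) : (K ⊗[ℚ] V) ≃ₗ[K] (K ⊗[ℚ] V))
    rw [← glExtendScalarsHom_apply, map_mul, glExtendScalarsHom_apply, glExtendScalarsHom_apply]
  · have h1 := congrArg (fun x : Subgroup.center (ψ.lefschetzGroupBaseChange L) =>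
      ((x : ψ.lefschetzGroupBaseChange L) : (L ⊗[ℚ] V) ≃ₗ[L] (L ⊗[ℚ] V))) h
    exact Subtype.ext (Subtype.ext (glExtendScalars_injective K L V h1))

/-- **`Z(S(H)(K))` INFINITE ⟹ `Z(S(H)(L))` INFINITE**, for all fields `ℚ ⊆ K ⊆ L` (type IV is seen by every larger coefficient
field; g54-#10 is `K = ℚ`). [cite: Milne1999LefschetzClasses, §1 Remark 1.6 (p. 644) and §2 Summary p. 652] [cite: MoonenZarhin1998WeilClasses, §1 Lemma (1)] -/
theorem Polarization.infinite_center_lefschetzGroupBaseChange_of_infinite_of_tower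
    [Infinite (Subgroup.center (ψ.lefschetzGroupBaseChange K))] :
    Infinite (Subgroup.center (ψ.lefschetzGroupBaseChange L)) := by
  obtain ⟨f, hf, -⟩ := ψ.exists_center_lefschetzGroupBaseChange_monoidHom_injective K L
  exact Infinite.of_injective f hf

/-- **`Z(S(H)(L))` FINITE ⟹ `Z(S(H)(K))` FINITE.** [cite: Milne1999LefschetzClasses, §1 Remark 1.6 (p. 644) and §2 Summary p. 652] -/
theorem Polarization.finite_center_lefschetzGroupBaseChange_of_finite_of_tower
    [Finite (Subgroup.center (ψ.lefschetzGroupBaseChange L))] :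
    Finite (Subgroup.center (ψ.lefschetzGroupBaseChange K)) := by
  obtain ⟨f, hf, -⟩ := ψ.exists_center_lefschetzGroupBaseChange_monoidHom_injective K L
  exact Finite.of_injective f hf

/-- **`#Z(S(H)(K)) ≤ #Z(S(H)(L))` WHENEVER THE LATTER IS FINITE** (first kind). [cite: Milne1999LefschetzClasses, §1 Remark 1.6 (p. 644) and p. 645 L2–L14 (`S₀`, Prop. 1.7)] -/
theorem Polarization.natCard_center_lefschetzGroupBaseChange_le_of_finite
    [Finite (Subgroup.center (ψ.lefschetzGroupBaseChange L))] :
    Nat.card (Subgroup.center (ψ.lefschetzGroupBaseChange K)) ≤ Nat.card (Subgroup.center (ψ.lefschetzGroupBaseChange L)) := by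
  obtain ⟨f, hf, -⟩ := ψ.exists_center_lefschetzGroupBaseChange_monoidHom_injective K L
  exact Nat.card_le_card_of_injective f hf

/-- **`#Z(S(H)(K))` DIVIDES `#Z(S(H)(L))`** (`Z(S(H)(K))` embeds as a subgroup; for the first kind `2^{t_K} ∣ 2^{t_L}`; for an
infinite `Z(S(H)(L))` both sides read `0`-conventions of `Nat.card`). [cite: Milne1999LefschetzClasses, §1 Remark 1.6 (p. 644) and p. 645 L2–L14] -/
theorem Polarization.natCard_center_lefschetzGroupBaseChange_dvd :
    Nat.card (Subgroup.center (ψ.lefschetzGroupBaseChange K)) ∣ Nat.card (Subgroup.center (ψ.lefschetzGroupBaseChange L)) := by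
  obtain ⟨f, hf, -⟩ := ψ.exists_center_lefschetzGroupBaseChange_monoidHom_injective K L
  exact Subgroup.card_dvd_of_injective f hf

/-! ## §3 First kind: `#Z(S(H)(K)) = 2^{t_K} ≤ 2^{t_L} = #Z(S(H)(L))`, with equality iff `t_K = t_L` -/

set_option maxSynthPendingDepth 4 in
/-- **FIRST KIND: `#Z(S(A)(K)) ≤ #Z(S(A)(L))` FOR ALL FIELDS `ℚ ⊆ K ⊆ L`** (`Z(S(H)(L))` is finite of order `2^{t_L}`, g55-#8; g55-#8's
`…lefschetzGroup_le…` is `K = ℚ`). [cite: Milne1999LefschetzClasses, §1 Remark 1.6 (p. 644), p. 645 L2–L14 and §2 Summary p. 652]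
[cite: MoonenZarhin1998WeilClasses, §1 Lemma (1)] -/
theorem Polarization.natCard_center_lefschetzGroupBaseChange_le_of_forall_adjoint_eq_self
    (hfix : ∀ z : H.endAlg, z ∈ Subalgebra.center ℚ H.endAlg → ψ.adjoint (z : Module.End ℚ V) = z) :
    Nat.card (Subgroup.center (ψ.lefschetzGroupBaseChange K)) ≤ Nat.card (Subgroup.center (ψ.lefschetzGroupBaseChange L)) := by
  haveI := ψ.finite_center_lefschetzGroupBaseChange_of_forall_adjoint_eq_self L hfix
  exact ψ.natCard_center_lefschetzGroupBaseChange_le_of_finite K L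

set_option maxSynthPendingDepth 4 in
omit [Algebra K L] [IsScalarTower ℚ K L] in
/-- **FIRST KIND: `#Z(S(H)(K)) = #Z(S(H)(L)) ⟺ t_K = t_L`** (`2^{t_K} = 2^{t_L}`; by row g56-#1 `t_K ≤ t_L` always, so this is the case
«no factor of `C₀ ⊗ K` splits further in `L`», e.g. `K` already splitting `C₀`). [cite: Milne1999LefschetzClasses, §1 Remark 1.6 (p. 644), p. 645 L2–L14 and §2 p. 646 L33–L38] -/
theorem Polarization.natCard_center_lefschetzGroupBaseChange_eq_iff_natCard_maximalSpectrum_eq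
    (hfix : ∀ z : H.endAlg, z ∈ Subalgebra.center ℚ H.endAlg → ψ.adjoint (z : Module.End ℚ V) = z) :
    Nat.card (Subgroup.center (ψ.lefschetzGroupBaseChange K)) = Nat.card (Subgroup.center (ψ.lefschetzGroupBaseChange L)) ↔
      Nat.card (MaximalSpectrum (Subalgebra.center K (Subalgebra.centralizer K
          ((fun a : Module.End ℚ V => a.baseChange K) '' (H.endAlg : Set (Module.End ℚ V)))))) =
        Nat.card (MaximalSpectrum (Subalgebra.center L (Subalgebra.centralizer L
          ((fun a : Module.End ℚ V => a.baseChange L) '' (H.endAlg : Set (Module.End ℚ V)))))) := by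
  rw [ψ.natCard_center_lefschetzGroupBaseChange_eq_two_pow K hfix, ψ.natCard_center_lefschetzGroupBaseChange_eq_two_pow L hfix]
  exact (Nat.pow_right_injective le_rfl).eq_iff

set_option maxSynthPendingDepth 4 in
/-- **FIRST KIND: THE EMBEDDING `Z(S(H)(K)) ↪ Z(S(H)(L))` IS A BIJECTION IFF `t_K = t_L`** (both finite; an injection between finite
sets of the same size). [cite: Milne1999LefschetzClasses, §1 Remark 1.6 (p. 644), p. 645 L2–L14 and §2 p. 646 L33–L38] -/
theorem Polarization.exists_center_lefschetzGroupBaseChange_mulEquiv_of_natCard_maximalSpectrum_eq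
    (hfix : ∀ z : H.endAlg, z ∈ Subalgebra.center ℚ H.endAlg → ψ.adjoint (z : Module.End ℚ V) = z)
    (ht : Nat.card (MaximalSpectrum (Subalgebra.center K (Subalgebra.centralizer K
          ((fun a : Module.End ℚ V => a.baseChange K) '' (H.endAlg : Set (Module.End ℚ V)))))) =
        Nat.card (MaximalSpectrum (Subalgebra.center L (Subalgebra.centralizer L
          ((fun a : Module.End ℚ V => a.baseChange L) '' (H.endAlg : Set (Module.End ℚ V))))))) :
    ∃ e : Subgroup.center (ψ.lefschetzGroupBaseChange K) ≃* Subgroup.center (ψ.lefschetzGroupBaseChange L),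
      ∀ γ : Subgroup.center (ψ.lefschetzGroupBaseChange K),
        (((e γ : Subgroup.center (ψ.lefschetzGroupBaseChange L)) : ψ.lefschetzGroupBaseChange L) :
            (L ⊗[ℚ] V) ≃ₗ[L] (L ⊗[ℚ] V)) =
          glExtendScalars K L V ((γ : ψ.lefschetzGroupBaseChange K) : (K ⊗[ℚ] V) ≃ₗ[K] (K ⊗[ℚ] V)) := by
  haveI := ψ.finite_center_lefschetzGroupBaseChange_of_forall_adjoint_eq_self K hfix
  haveI := ψ.finite_center_lefschetzGroupBaseChange_of_forall_adjoint_eq_self L hfix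
  obtain ⟨f, hf, hfγ⟩ := ψ.exists_center_lefschetzGroupBaseChange_monoidHom_injective K L
  have hcard := (ψ.natCard_center_lefschetzGroupBaseChange_eq_iff_natCard_maximalSpectrum_eq K L hfix).2 ht
  have hbij : Function.Bijective f := by
    haveI := Fintype.ofFinite (Subgroup.center (ψ.lefschetzGroupBaseChange K))
    haveI := Fintype.ofFinite (Subgroup.center (ψ.lefschetzGroupBaseChange L))
    rw [Nat.card_eq_fintype_card, Nat.card_eq_fintype_card] at hcard
    exact (Fintype.bijective_iff_injective_and_card f).2 ⟨hf, hcard⟩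
  exact ⟨MulEquiv.ofBijective f hbij, fun γ => hfγ γ⟩

end Centre

end HodgeStructure

end Literature.AlgebraicGeometry.Motives
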